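import Summits.QuantumAdvantage.QuantumAdvantage.Theorems.RandomOracleGaugeOneBlockDecouplingStubComparisonMoments

/-!
# Crux `OneBlockDecoupling` (stmt-QuantumAdvantage-17873, route RandomOracleGauge), line `odonnell-zhao` — stub `stub_comparison`, part 2/2 (influences)

O'Donnell–Zhao, *Polynomial bounds for decoupling, with applications*, arXiv:1512.01603, proof of Thm. 2.13
(the Parseval comparison), continued from `…StubComparisonMoments.lean` (part 1: `E q = 1/2`,
`Var q = (1/16C²) Σ_i Inf_i[p]`). For `q ∈ ℝ[Fin (N+N)]` realising `1/2 + dec p/(2C)` on the glued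
cube:

* **`Inf_{y_i} q = Inf_i[p]/(4C²)`** (`influence_castAdd_realised`: flipping `y_i` flips the sign of the `i`-th
  slice only);
* **`Inf_{z_k} q ≤ (d/4C²) Inf_k[p]`** (`influence_natAdd_realised_le`: flipping `z_k` flips `χ_{S∖i}` for
  `S ∋ k`, `i ≠ k`; `Σ_i Σ_{S∋i,k} p̂(S)² = Σ_{S∋k} |S| p̂(S)² ≤ d Σ_{S∋k} p̂(S)²` since a polynomial of total
  degree `≤ d` has no Walsh weight above level `d`);
* **`stub_comparison`** — the registered stub of `Cruxes/AAConj/Lines/odonnell_zhao.lean`, BY NAME: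
  `Var p ≤ 4C² Var q` and every influence of `q` is `≤ (d/C²)·`(an influence of `p`).

Elementary; no named facts, no new definitions.
-/

-- D-0017: single-conjunct summit ⇒ the duplicate `QuantumAdvantage.QuantumAdvantage` is mandated.
set_option linter.dupNamespace false

noncomputable section

open Finset
open Literature.Computability.QuantumComplexity
open Literature.Probability.RandomGraphs.LowDegree (sgn walsh)
open Literature.Computability.Complexity.LowDegree (cubeFourierCoeff)
open Summit.QuantumAdvantage.QuantumAdvantage.Theses.RandomOracleGauge

namespace Summit.QuantumAdvantage.QuantumAdvantage.Cruxes.OneBlockDecoupling.OdonnellZhao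

namespace StubComparison

variable {N : ℕ} {p : MvPolynomial (Fin N) ℝ} {C : ℝ} {q : MvPolynomial (Fin (N + N)) ℝ}

/-- **Influence of a `y`-variable**: `Inf_{y_i} q = Inf_i[p]/(4C²)`. [cite: ODonnellZhao2016, proof of Thm. 2.13] -/
theorem influence_castAdd_realised (hC : 0 < C) (i : Fin N)
    (hq : ∀ (y z : Fin N → Bool), evalBool q (Fin.append y z) =
      1 / 2 + (∑ S : Finset (Fin N), cubeFourierCoeff (evalBool p) S *
        ∑ i ∈ S, sgn (y i) * ∏ j ∈ S.erase i, sgn (z j)) / (2 * C)) :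
    influence (Fin.castAdd N i) q = influence i p / (4 * C ^ 2) := by
  classical
  rw [show influence (Fin.castAdd N i) q = (∑ x, (evalBool q x - evalBool q (flipBit (Fin.castAdd N i) x)) ^ 2) /
    (2 : ℝ) ^ (N + N) from rfl]
  rw [sum_cube_append]
  simp_rw [flipBit_castAdd_append, hq, dec_eq_sum_slices]
  -- the difference of the two sliced sums is `2 sgn(y_i) G_i(z)`
  have hdiff : ∀ y z : Fin N → Bool,
      (1 : ℝ) / 2 + (∑ l, sgn (y l) * ∑ S : Finset (Fin N), (if l ∈ S then cubeFourierCoeff (evalBool p) S *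
          ∏ j ∈ S.erase l, sgn (z j) else 0)) / (2 * C) -
        (1 / 2 + (∑ l, sgn (flipBit i y l) * ∑ S : Finset (Fin N),
          (if l ∈ S then cubeFourierCoeff (evalBool p) S * ∏ j ∈ S.erase l, sgn (z j) else 0)) / (2 * C)) =
      sgn (y i) * (∑ S : Finset (Fin N), (if i ∈ S then cubeFourierCoeff (evalBool p) S *
          ∏ j ∈ S.erase i, sgn (z j) else 0)) / C := by
    intro y z
    have hterm : ∀ l, sgn (y l) * ∑ S : Finset (Fin N), (if l ∈ S then cubeFourierCoeff (evalBool p) S *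
          ∏ j ∈ S.erase l, sgn (z j) else 0) -
        sgn (flipBit i y l) * ∑ S : Finset (Fin N), (if l ∈ S then cubeFourierCoeff (evalBool p) S *
          ∏ j ∈ S.erase l, sgn (z j) else 0) =
        if l = i then 2 * sgn (y i) * ∑ S : Finset (Fin N), (if i ∈ S then cubeFourierCoeff (evalBool p) S *
          ∏ j ∈ S.erase i, sgn (z j) else 0) else 0 := by
      intro l
      by_cases h : l = i
      · subst h
        rw [if_pos rfl]
        simp only [flipBit, Function.update_self]
        cases y l <;> simp [sgn] <;> ring
      · rw [if_neg h]
        simp [flipBit, Function.update_of_ne h]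
    have : (∑ l, sgn (y l) * ∑ S : Finset (Fin N), (if l ∈ S then cubeFourierCoeff (evalBool p) S *
          ∏ j ∈ S.erase l, sgn (z j) else 0)) -
        (∑ l, sgn (flipBit i y l) * ∑ S : Finset (Fin N),
          (if l ∈ S then cubeFourierCoeff (evalBool p) S * ∏ j ∈ S.erase l, sgn (z j) else 0)) =
        2 * sgn (y i) * ∑ S : Finset (Fin N), (if i ∈ S then cubeFourierCoeff (evalBool p) S *
          ∏ j ∈ S.erase i, sgn (z j) else 0) := by
      rw [← Finset.sum_sub_distrib]
      simp_rw [hterm]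
      rw [Finset.sum_ite_eq' Finset.univ i]; simp
    have hC0 : C ≠ 0 := hC.ne'
    field_simp
    rw [← this]
    ring
  simp_rw [hdiff]
  have hsq : ∀ y z : Fin N → Bool, (sgn (y i) * (∑ S : Finset (Fin N), (if i ∈ S then
      cubeFourierCoeff (evalBool p) S * ∏ j ∈ S.erase i, sgn (z j) else 0)) / C) ^ 2 =
      (∑ S : Finset (Fin N), (if i ∈ S then cubeFourierCoeff (evalBool p) S *
        ∏ j ∈ S.erase i, sgn (z j) else 0)) ^ 2 / C ^ 2 := by
    intro y z
    rw [mul_div_assoc, mul_pow, div_pow]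
    have : sgn (y i) ^ 2 = 1 := by cases y i <;> simp [sgn]
    rw [this, one_mul]
  simp_rw [hsq]
  simp only [Finset.sum_const, Finset.card_univ, Fintype.card_fun, Fintype.card_bool, Fintype.card_fin,
    nsmul_eq_mul]
  rw [← Finset.sum_div, sum_sq_slice, influence_eq_sum_sq_fourier, pow_add]
  push_cast
  field_simp

/-- **Influence of a `z`-variable**: `Inf_{z_k} q ≤ (d/4C²)·Inf_k[p]` for `p.totalDegree ≤ d`.
[cite: ODonnellZhao2016, proof of Thm. 2.13] -/
theorem influence_natAdd_realised_le (hC : 0 < C) {d : ℕ} (hp : p.totalDegree ≤ d) (k : Fin N)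
    (hq : ∀ (y z : Fin N → Bool), evalBool q (Fin.append y z) =
      1 / 2 + (∑ S : Finset (Fin N), cubeFourierCoeff (evalBool p) S *
        ∑ i ∈ S, sgn (y i) * ∏ j ∈ S.erase i, sgn (z j)) / (2 * C)) :
    influence (Fin.natAdd N k) q ≤ d / (4 * C ^ 2) * influence k p := by
  classical
  set P := cubeFourierCoeff (evalBool p) with hP
  -- Step 1: the influence as a sum over slices
  have hI : influence (Fin.natAdd N k) q =
      (∑ i, ∑ z : Fin N → Bool, ((∑ S : Finset (Fin N), (if i ∈ S then P S * ∏ j ∈ S.erase i, sgn (z j) else 0)) -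
        (∑ S : Finset (Fin N), (if i ∈ S then P S * ∏ j ∈ S.erase i, sgn (flipBit k z j) else 0))) ^ 2) /
        (2 ^ N * (2 * C) ^ 2) := by
    unfold influence
    unfold boolAvg
    rw [sum_cube_append]
    simp_rw [flipBit_natAdd_append, hq, dec_eq_sum_slices, hP]
    have hdiff : ∀ y z : Fin N → Bool,
        (1 : ℝ) / 2 + (∑ l, sgn (y l) * ∑ S : Finset (Fin N), (if l ∈ S then cubeFourierCoeff (evalBool p) S *
            ∏ j ∈ S.erase l, sgn (z j) else 0)) / (2 * C) -
          (1 / 2 + (∑ l, sgn (y l) * ∑ S : Finset (Fin N), (if l ∈ S then cubeFourierCoeff (evalBool p) S *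
            ∏ j ∈ S.erase l, sgn (flipBit k z j) else 0)) / (2 * C)) =
        (∑ l, sgn (y l) * ((∑ S : Finset (Fin N), (if l ∈ S then cubeFourierCoeff (evalBool p) S *
            ∏ j ∈ S.erase l, sgn (z j) else 0)) -
          (∑ S : Finset (Fin N), (if l ∈ S then cubeFourierCoeff (evalBool p) S *
            ∏ j ∈ S.erase l, sgn (flipBit k z j) else 0)))) / (2 * C) := by
      intro y z
      rw [add_sub_add_left_eq_sub, ← sub_div, ← Finset.sum_sub_distrib]
      congr 1
      exact Finset.sum_congr rfl fun l _ => by ring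
    simp_rw [hdiff, div_pow]
    rw [Finset.sum_comm]
    have hin : ∀ z : Fin N → Bool, ∑ y : Fin N → Bool, (∑ l, sgn (y l) *
        ((∑ S : Finset (Fin N), (if l ∈ S then cubeFourierCoeff (evalBool p) S * ∏ j ∈ S.erase l, sgn (z j) else 0)) -
          (∑ S : Finset (Fin N), (if l ∈ S then cubeFourierCoeff (evalBool p) S *
            ∏ j ∈ S.erase l, sgn (flipBit k z j) else 0)))) ^ 2 / (2 * C) ^ 2 =
        (2 ^ N * ∑ l, ((∑ S : Finset (Fin N), (if l ∈ S then cubeFourierCoeff (evalBool p) S *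
            ∏ j ∈ S.erase l, sgn (z j) else 0)) -
          (∑ S : Finset (Fin N), (if l ∈ S then cubeFourierCoeff (evalBool p) S *
            ∏ j ∈ S.erase l, sgn (flipBit k z j) else 0))) ^ 2) / (2 * C) ^ 2 := by
      intro z
      rw [← Finset.sum_div, sum_sq_sum_sgn]
    simp_rw [hin]
    rw [← Finset.sum_div, ← Finset.mul_sum, Finset.sum_comm, pow_add]
    field_simp
  -- Step 2: Parseval for each flipped slice and the row-weight bound
  have hstep : ∀ i : Fin N, ∑ z : Fin N → Bool,
      ((∑ S : Finset (Fin N), (if i ∈ S then P S * ∏ j ∈ S.erase i, sgn (z j) else 0)) -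
        (∑ S : Finset (Fin N), (if i ∈ S then P S * ∏ j ∈ S.erase i, sgn (flipBit k z j) else 0))) ^ 2 ≤
      2 ^ N * (4 * ∑ S ∈ Finset.univ.filter (fun S : Finset (Fin N) => k ∈ S), (if i ∈ S then P S ^ 2 else 0)) := by
    intro i
    rw [sum_sq_slice_sub_flip P i k]
    exact mul_le_mul_of_nonneg_left (sum_flip_coeff_sq_le P i k) (by positivity)
  -- Step 3: `Σ_i Σ_{S∋k} [i∈S] p̂(S)² = Σ_{S∋k} |S| p̂(S)² ≤ d Σ_{S∋k} p̂(S)² = d·Inf_k[p]/4`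
  have hrow : ∑ i : Fin N, ∑ S ∈ Finset.univ.filter (fun S : Finset (Fin N) => k ∈ S),
      (if i ∈ S then P S ^ 2 else 0) ≤ d * (influence k p / 4) := by
    rw [Finset.sum_comm, influence_eq_sum_sq_fourier, ← hP]
    have h4 : (4 : ℝ) * (∑ S ∈ Finset.univ.filter (fun S : Finset (Fin N) => k ∈ S), P S ^ 2) / 4 =
        ∑ S ∈ Finset.univ.filter (fun S : Finset (Fin N) => k ∈ S), P S ^ 2 := by ring
    rw [h4, Finset.mul_sum]
    refine Finset.sum_le_sum fun S _ => ?_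
    have hcard : ∑ i : Fin N, (if i ∈ S then P S ^ 2 else 0) = S.card * P S ^ 2 := by
      rw [← Finset.sum_filter]
      have : Finset.univ.filter (fun i : Fin N => i ∈ S) = S := by ext i; simp
      rw [this, Finset.sum_const, nsmul_eq_mul]
    rw [hcard]
    by_cases hS : d < S.card
    · rw [hP, cubeFourierCoeff_evalBool_eq_zero hp hS]; simp
    · push Not at hS
      exact mul_le_mul_of_nonneg_right (by exact_mod_cast hS) (sq_nonneg _)
  -- assemble
  rw [hI, div_le_iff₀ (by positivity)]
  calc ∑ i, ∑ z : Fin N → Bool, ((∑ S : Finset (Fin N), (if i ∈ S then P S * ∏ j ∈ S.erase i, sgn (z j) else 0)) -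
        (∑ S : Finset (Fin N), (if i ∈ S then P S * ∏ j ∈ S.erase i, sgn (flipBit k z j) else 0))) ^ 2
      ≤ ∑ i : Fin N, 2 ^ N * (4 * ∑ S ∈ Finset.univ.filter (fun S : Finset (Fin N) => k ∈ S),
          (if i ∈ S then P S ^ 2 else 0)) := Finset.sum_le_sum fun i _ => hstep i
    _ = 2 ^ N * 4 * ∑ i : Fin N, ∑ S ∈ Finset.univ.filter (fun S : Finset (Fin N) => k ∈ S),
          (if i ∈ S then P S ^ 2 else 0) := by rw [Finset.mul_sum]; exact Finset.sum_congr rfl fun i _ => by ring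
    _ ≤ 2 ^ N * 4 * (d * (influence k p / 4)) := mul_le_mul_of_nonneg_left hrow (by positivity)
    _ = d / (4 * C ^ 2) * influence k p * (2 ^ N * (2 * C) ^ 2) := by field_simp; ring

end StubComparison

open StubComparison in
/-- **Stub `stub_comparison` of line `odonnell-zhao`** (registered signature, BY NAME): if `q ∈ ℝ[Fin (N+N)]`
realises `1/2 + dec p/(2C)` on the glued cube (`C > 0`, `p.totalDegree ≤ d`, `d ≥ 1`), then
`Var p ≤ 4C²·Var q` and every influence of `q` is at most `(d/C²)·`(some influence of `p`) — precisely
`Inf_{y_i} q = Inf_i[p]/(4C²)` and `Inf_{z_k} q ≤ (d/4C²)·Inf_k[p]`. The Parseval comparison in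
O'Donnell–Zhao's proof of their Thm. 2.13. [cite: ODonnellZhao2016, proof of Thm. 2.13] -/
theorem stub_comparison :
    ∀ (N d : ℕ) (p : MvPolynomial (Fin N) ℝ) (C : ℝ) (q : MvPolynomial (Fin (N + N)) ℝ), 1 ≤ d →
      p.totalDegree ≤ d → 0 < C →
      (∀ (y z : Fin N → Bool), evalBool q (Fin.append y z) =
          1 / 2 + (∑ S : Finset (Fin N), cubeFourierCoeff (evalBool p) S *
            ∑ i ∈ S, sgn (y i) * ∏ j ∈ S.erase i, sgn (z j)) / (2 * C)) →
      boolVariance p ≤ 4 * C ^ 2 * boolVariance q ∧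
      ∀ j : Fin (N + N), ∃ i : Fin N, influence j q ≤ d / C ^ 2 * influence i p := by
  intro N d p C q hd hdeg hC hq
  refine ⟨?_, ?_⟩
  · rw [boolVariance_realised hC hq]
    -- Poincaré in Walsh form: `4 Var p ≤ Σ_i Inf_i[p]` (`Var p = Σ_{S≠∅} p̂(S)²`, `Σ_i Inf_i = 4 Σ_S |S| p̂(S)²`;
    -- also in the tree as `FHKL.four_mul_boolVariance_le_sum_influence`, inlined here to keep the import cone small)
    have h : 4 * boolVariance p ≤ ∑ i, influence i p := by
      classical
      rw [sum_influence_eq,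
        Summit.QuantumAdvantage.QuantumAdvantage.Theorems.SosSandwich.LevelKRung.boolVariance_eq_sum_nonempty,
        Finset.sum_filter]
      refine mul_le_mul_of_nonneg_left (Finset.sum_le_sum fun S _ => ?_) (by norm_num)
      by_cases hS : S ≠ ∅
      · rw [if_pos hS]
        have h1 : (1 : ℝ) ≤ S.card := by
          exact_mod_cast Finset.card_pos.mpr (Finset.nonempty_iff_ne_empty.mpr hS)
        nlinarith [sq_nonneg (cubeFourierCoeff (evalBool p) S)]
      · rw [if_neg hS]
        positivity
    rw [mul_div_assoc', le_div_iff₀ (by positivity)]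
    nlinarith [sq_nonneg C]
  · intro j
    cases j using Fin.addCases with
    | left i =>
      refine ⟨i, ?_⟩
      rw [influence_castAdd_realised hC i hq]
      have hI : 0 ≤ influence i p := influence_nonneg i p
      have hd1 : (1 : ℝ) ≤ d := by exact_mod_cast hd
      rw [div_eq_mul_inv, mul_comm]
      apply mul_le_mul_of_nonneg_right _ hI
      rw [← one_div]
      calc (1 : ℝ) / (4 * C ^ 2) ≤ 1 / C ^ 2 :=
            div_le_div_of_nonneg_left (by norm_num) (by positivity) (by nlinarith [sq_nonneg C])
        _ ≤ d / C ^ 2 := div_le_div_of_nonneg_right hd1 (by positivity)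
    | right k =>
      refine ⟨k, (influence_natAdd_realised_le hC hdeg k hq).trans ?_⟩
      have hI : 0 ≤ influence k p := influence_nonneg k p
      apply mul_le_mul_of_nonneg_right _ hI
      apply div_le_div_of_nonneg_left (by positivity) (by positivity)
      nlinarith [sq_nonneg C]

end Summit.QuantumAdvantage.QuantumAdvantage.Cruxes.OneBlockDecoupling.OdonnellZhao

end
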